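import Mathlib
import HarnessLib

/-!
# First-passage overshoot of the Katz–Pavlović chain: the successor's catch-up, DERIVED
(helper file under the crux `SubOnsagerCeiling.ForwardTailCeilingKP`, stmt-NavierStokesRegularity-27057,
`--supports`; MODEL lattice only)

The tree's peak calculus for the positive viscous chain
`Ż_k = c₀ (b^{5(k-1)/2} Z_{k-1}² − b^{5k/2} Z_k Z_{k+1}) − ν b^{2k} Z_k`
(`Theorems/SubOnsagerCeilingKPChainPeak.lean`, `…KPChainFirstOvershoot.lean`) is STATIC: at a peak time of the
shell `k`, IF the successor `Z_{k+1}` has caught up to a fraction `ρ` of the peak, the peak is controlled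
(`sq_peak_le_of_catchup`, `barrier_of_catchup`), and the catch-up fraction is an INPUT measured in numerics.
This file DERIVES the catch-up from the successor's own equation and bounds the overshoot of ONE passage of
the front, with no catch-up hypothesis:

* `overshoot_le_of_growthPhase` (abstract four-shell window, all weights symbolic — no powers of `b`): on a
  window where the shell behind stays under its plateau (`c_f x² ≤ c_d A A₁`: feed at most the equilibrium drain
  of the Kolmogorov steps `A` of shell `k`, `A₁` of shell `k+1`), shell `k` is at or above its step (`y ≥ A`),
  the successor is below its step (`0 ≤ z ≤ A₁`) and the drain of the successor by the shell two ahead plus its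
  dissipation is at most HALF its feed scale (`(c_e w + ν_z) A₁ ≤ c_d A²/2` — an INPUT: sharpness of the front two
  shells ahead and `ν`; the tree's light cone `…KPChainLightCone.lean` gives it only from the datum time), the
  successor grows at least linearly, `z(t) ≥ z(t₀) + (c_d A²/2)(t − t₀)` (`successor_growth`), hence the drain of
  shell `k` grows at least linearly and `y(t) ≤ y(t₀) + A₁²/A` (completing the square); the phase lasts at most
  `2A₁/(c_d A²)` (`growthPhase_duration`);
* `antitoneOn_of_successorHigh` — once the successor is at or above its step (`z ≥ A₁`) while `y ≥ A` and the
  plateau bound holds, shell `k` is non-increasing (feed ≤ drain);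
* `overshoot_le_of_episode` — the two glued at a switch time: over a whole first-passage episode
  `y ≤ y(t₀) + A₁²/A`;
* `kpChain_firstPassage_overshoot` — the chain itself in the hypotheses' format of the LEAD's rungs
  (`Theorems.VirtualFloor.GapRung.gap_chain10`, `Theorems.KPChainPeak.*`): with the Kolmogorov steps
  `A₁ = b^{-5/6} A` and the plateau `Z_{k-1}² ≤ b^{5/3} A²`, a growth phase entered at the step (`Z_k(t₀) = A`)
  overshoots by at most the factor `1 + b^{-5/3} ≤ 2` in amplitude: `Z_k ≤ (1 + b^{-5/3}) A` on the phase,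
  UNIFORMLY in `b > 0`, `ν ≥ 0`, `c₀ > 0`, `k` and the window (`kpChain_firstPassage_overshoot_sq`:
  `b^{5/3} Z_k² ≤ 4 · (b^{5/3} A²)` — four times the plateau energy in the Kolmogorov-weighted currency).

READING (census (A′1) of hands 4-g13/4-g14 on the item: «universal O(1) overshoot of the lattice shock»,
measured `A ≈ 1.40` as `b ↓ 1`): the per-passage overshoot is an absolute constant because the successor's
catch-up is forced by the very amplitude that overshoots; what this lemma does NOT control is COMPOUNDING across
shells (the plateau of shell `k+1` is the overshot shell `k`), which is the whole difficulty of the stubs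
(`stub_primaryGradedLargeRatio/SmallRatio`, open): an amplitude factor `f` per shell costs `log_b f` in the
exponent, and `θ > 1/2` tolerates only `f < b^{1/3}` — so a proof must show the overshoots relax (multi-shell
memory), as the LEAD's certified four-window regions do for `b ∈ [34/25, 2]`. Nothing here closes a stub.
HONEST FRAMING: statements about MODEL lattice ODEs (route SubOnsagerCeiling, rung TL-M2Break); nothing here
bears on Navier–Stokes regularity and no crux or summit is proved.
[cite: BarbatoMorandinRomito2011, §2 Lemma 2.1 (invariant-region faces for the dyadic chain at one ratio)]
[cite: Tao2016AveragedNS, §4 (4.13) (the viscous model equation)]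
-/

noncomputable section

-- the sub-problem namespace `NavierStokesRegularity.NavierStokesRegularity` is the tree's layout (D-0017)
set_option linter.dupNamespace false

namespace Summit.NavierStokesRegularity.NavierStokesRegularity.Theorems.KPChainFirstPassage

open Set

/-! ## Two calculus facts on a window `[t₀, t₁]` -/

/-- A function with non-negative derivative within `[t₀,t₁]` at every point of the window lies above its
initial value. [folklore] -/
theorem le_of_derivWithin_nonneg {f f' : ℝ → ℝ} {t₀ t₁ : ℝ}
    (hf : ∀ t ∈ Icc t₀ t₁, HasDerivWithinAt f (f' t) (Icc t₀ t₁) t)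
    (hpos : ∀ t ∈ Icc t₀ t₁, 0 ≤ f' t) : ∀ t ∈ Icc t₀ t₁, f t₀ ≤ f t := by
  intro t ht
  have hmono : MonotoneOn f (Icc t₀ t₁) := by
    apply monotoneOn_of_hasDerivWithinAt_nonneg (convex_Icc t₀ t₁) (f' := f')
    · exact fun τ hτ => (hf τ hτ).continuousWithinAt
    · intro τ hτ
      have hτ' : τ ∈ Icc t₀ t₁ := interior_subset hτ
      exact (hf τ hτ').mono interior_subset
    · intro τ hτ
      exact hpos τ (interior_subset hτ)
  exact hmono (left_mem_Icc.mpr (ht.1.trans ht.2)) ht ht.1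

/-- A function with non-positive derivative within `[t₀,t₁]` at every point of the window lies below its
initial value. [folklore] -/
theorem le_of_derivWithin_nonpos {f f' : ℝ → ℝ} {t₀ t₁ : ℝ}
    (hf : ∀ t ∈ Icc t₀ t₁, HasDerivWithinAt f (f' t) (Icc t₀ t₁) t)
    (hneg : ∀ t ∈ Icc t₀ t₁, f' t ≤ 0) : ∀ t ∈ Icc t₀ t₁, f t ≤ f t₀ := by
  intro t ht
  have hanti : AntitoneOn f (Icc t₀ t₁) := by
    apply antitoneOn_of_hasDerivWithinAt_nonpos (convex_Icc t₀ t₁) (f' := f')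
    · exact fun τ hτ => (hf τ hτ).continuousWithinAt
    · intro τ hτ
      have hτ' : τ ∈ Icc t₀ t₁ := interior_subset hτ
      exact (hf τ hτ').mono interior_subset
    · intro τ hτ
      exact hneg τ (interior_subset hτ)
  exact hanti (left_mem_Icc.mpr (ht.1.trans ht.2)) ht ht.1

/-! ## The abstract four-shell window: `x` behind, `y` the shell, `z` the successor, `w` two ahead -/

/-- **The successor's growth in a growth phase.** If on `[t₀,t₁]` the successor `z` obeys
`ż = c_d y² − c_e z w − ν_z z` with `y ≥ A > 0`, `z ≤ A₁`, `w ≥ 0`, `c_d, c_e, ν_z ≥ 0` and the drain-plus-dissipation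
smallness `(c_e w + ν_z) A₁ ≤ c_d A²/2`, then `z(t) ≥ z(t₀) + (c_d A²/2)(t − t₀)`. [this file] -/
theorem successor_growth {y z w : ℝ → ℝ} {t₀ t₁ cd ce νz A A₁ : ℝ}
    (hce : 0 ≤ ce) (hνz : 0 ≤ νz) (hA : 0 < A)
    (hz : ∀ t ∈ Icc t₀ t₁, HasDerivWithinAt z (cd * y t ^ 2 - ce * (z t * w t) - νz * z t) (Icc t₀ t₁) t)
    (hyA : ∀ t ∈ Icc t₀ t₁, A ≤ y t) (hzA : ∀ t ∈ Icc t₀ t₁, z t ≤ A₁)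
    (hw : ∀ t ∈ Icc t₀ t₁, 0 ≤ w t) (hcd : 0 ≤ cd)
    (hdrain : ∀ t ∈ Icc t₀ t₁, (ce * w t + νz) * A₁ ≤ cd * A ^ 2 / 2) :
    ∀ t ∈ Icc t₀ t₁, z t₀ + cd * A ^ 2 / 2 * (t - t₀) ≤ z t := by
  -- `g τ := z τ − G (τ − t₀)` has non-negative derivative
  set G : ℝ := cd * A ^ 2 / 2 with hG
  have hg : ∀ τ ∈ Icc t₀ t₁, HasDerivWithinAt (fun τ => z τ - G * (τ - t₀))
      (cd * y τ ^ 2 - ce * (z τ * w τ) - νz * z τ - G) (Icc t₀ t₁) τ := by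
    intro τ hτ
    have h1 : HasDerivWithinAt (fun τ => G * (τ - t₀)) (G * 1) (Icc t₀ t₁) τ :=
      ((hasDerivWithinAt_id τ _).sub_const t₀).const_mul G
    have := (hz τ hτ).sub h1
    simpa only [Pi.sub_def, mul_one] using this
  have hpos : ∀ τ ∈ Icc t₀ t₁, 0 ≤ cd * y τ ^ 2 - ce * (z τ * w τ) - νz * z τ - G := by
    intro τ hτ
    have hy2 : A ^ 2 ≤ y τ ^ 2 := pow_le_pow_left₀ hA.le (hyA τ hτ) 2
    have hcoef : 0 ≤ ce * w τ + νz := by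
      have := hw τ hτ; positivity
    have hdr : (ce * w τ + νz) * z τ ≤ (ce * w τ + νz) * A₁ :=
      mul_le_mul_of_nonneg_left (hzA τ hτ) hcoef
    have hd2 := hdrain τ hτ
    have hfeed : cd * A ^ 2 ≤ cd * y τ ^ 2 := mul_le_mul_of_nonneg_left hy2 hcd
    have key : ce * (z τ * w τ) + νz * z τ = (ce * w τ + νz) * z τ := by ring
    rw [hG]
    linarith
  intro t ht
  have := le_of_derivWithin_nonneg hg hpos t ht
  simp only [sub_self, mul_zero, sub_zero] at this
  linarith

/-- **First-passage overshoot bound (growth phase).** On a window `[t₀,t₁]` let the shell `y` obey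
`ẏ = c_f x² − c_d y z − ν_y y` and its successor `z` obey `ż = c_d y² − c_e z w − ν_z z`, with `c_d > 0`,
`c_e, ν_y, ν_z ≥ 0`. Suppose: the shell behind stays under its plateau in the sense `c_f x² ≤ c_d A A₁`
(feed at most the equilibrium drain of the steps `A > 0`, `A₁`); `y ≥ A` (growth phase); `0 ≤ z ≤ A₁`
(successor below its step); `w ≥ 0`; and `(c_e w + ν_z) A₁ ≤ c_d A²/2`. Then `y(t) ≤ y(t₀) + A₁²/A` on the
window: the successor is forced to grow linearly (`successor_growth`), so the drain of `y` grows linearly and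
the excursion of `y` is at most the apex of a parabola. [this file] -/
theorem overshoot_le_of_growthPhase {x y z w : ℝ → ℝ} {t₀ t₁ cf cd ce νy νz A A₁ : ℝ}
    (hcd : 0 < cd) (hce : 0 ≤ ce) (hνy : 0 ≤ νy) (hνz : 0 ≤ νz) (hA : 0 < A)
    (hy : ∀ t ∈ Icc t₀ t₁, HasDerivWithinAt y (cf * x t ^ 2 - cd * (y t * z t) - νy * y t) (Icc t₀ t₁) t)
    (hz : ∀ t ∈ Icc t₀ t₁, HasDerivWithinAt z (cd * y t ^ 2 - ce * (z t * w t) - νz * z t) (Icc t₀ t₁) t)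
    (hfeed : ∀ t ∈ Icc t₀ t₁, cf * x t ^ 2 ≤ cd * (A * A₁))
    (hyA : ∀ t ∈ Icc t₀ t₁, A ≤ y t)
    (hz0 : ∀ t ∈ Icc t₀ t₁, 0 ≤ z t) (hzA : ∀ t ∈ Icc t₀ t₁, z t ≤ A₁)
    (hw : ∀ t ∈ Icc t₀ t₁, 0 ≤ w t)
    (hdrain : ∀ t ∈ Icc t₀ t₁, (ce * w t + νz) * A₁ ≤ cd * A ^ 2 / 2) :
    ∀ t ∈ Icc t₀ t₁, y t ≤ y t₀ + A₁ ^ 2 / A := by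
  have hgrow := successor_growth hce hνz hA hz hyA hzA hw hcd.le hdrain
  -- the parabola `p τ := y τ − α (τ − t₀) + (β/2) (τ − t₀)²`, `α = c_d A A₁`, `β = c_d A (c_d A²/2)`,
  -- is non-increasing on the window
  have hβpos : 0 < cd * A * (cd * A ^ 2 / 2) := by positivity
  have hp : ∀ τ ∈ Icc t₀ t₁, HasDerivWithinAt
      (fun τ => y τ - cd * (A * A₁) * (τ - t₀) + cd * A * (cd * A ^ 2 / 2) / 2 * ((τ - t₀) * (τ - t₀)))
      (cf * x τ ^ 2 - cd * (y τ * z τ) - νy * y τ - cd * (A * A₁) +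
        cd * A * (cd * A ^ 2 / 2) * (τ - t₀)) (Icc t₀ t₁) τ := by
    intro τ hτ
    have hid : HasDerivWithinAt (fun τ => τ - t₀) 1 (Icc t₀ t₁) τ := (hasDerivWithinAt_id τ _).sub_const t₀
    have h1 : HasDerivWithinAt (fun τ => cd * (A * A₁) * (τ - t₀)) (cd * (A * A₁) * 1) (Icc t₀ t₁) τ :=
      hid.const_mul _
    have h2 : HasDerivWithinAt (fun τ => cd * A * (cd * A ^ 2 / 2) / 2 * ((τ - t₀) * (τ - t₀)))
        (cd * A * (cd * A ^ 2 / 2) / 2 * (1 * (τ - t₀) + (τ - t₀) * 1)) (Icc t₀ t₁) τ :=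
      (hid.mul hid).const_mul _
    have h3 := ((hy τ hτ).sub h1).add h2
    have h4 : HasDerivWithinAt
        (fun τ => y τ - cd * (A * A₁) * (τ - t₀) + cd * A * (cd * A ^ 2 / 2) / 2 * ((τ - t₀) * (τ - t₀)))
        (cf * x τ ^ 2 - cd * (y τ * z τ) - νy * y τ - cd * (A * A₁) * 1 +
          cd * A * (cd * A ^ 2 / 2) / 2 * (1 * (τ - t₀) + (τ - t₀) * 1)) (Icc t₀ t₁) τ := by
      simpa only [Pi.sub_def, Pi.add_def] using h3
    refine h4.congr_deriv ?_
    ring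
  have hneg : ∀ τ ∈ Icc t₀ t₁, cf * x τ ^ 2 - cd * (y τ * z τ) - νy * y τ - cd * (A * A₁) +
      cd * A * (cd * A ^ 2 / 2) * (τ - t₀) ≤ 0 := by
    intro τ hτ
    have hzl := hgrow τ hτ
    have hz00 := hz0 t₀ (left_mem_Icc.mpr (hτ.1.trans hτ.2))
    have hyτ := hyA τ hτ
    have hy0 : 0 ≤ y τ := hA.le.trans hyτ
    have hzτ := hz0 τ hτ
    have h1 : cd * (A * z τ) ≤ cd * (y τ * z τ) :=
      mul_le_mul_of_nonneg_left (mul_le_mul_of_nonneg_right hyτ hzτ) hcd.le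
    have h2 : cd * A * (cd * A ^ 2 / 2 * (τ - t₀)) ≤ cd * A * z τ := by
      have : cd * A ^ 2 / 2 * (τ - t₀) ≤ z τ := by linarith
      exact mul_le_mul_of_nonneg_left this (by positivity)
    have h3 : 0 ≤ νy * y τ := mul_nonneg hνy hy0
    have h4 := hfeed τ hτ
    nlinarith
  intro t ht
  have hpar := le_of_derivWithin_nonpos hp hneg t ht
  simp only [sub_self, mul_zero, sub_zero, add_zero] at hpar
  -- `y t ≤ y t₀ + α u − (β/2) u² ≤ y t₀ + α²/(2β) = y t₀ + A₁²/A`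
  have hquad : cd * (A * A₁) * (t - t₀) - cd * A * (cd * A ^ 2 / 2) / 2 * ((t - t₀) * (t - t₀)) ≤
      (cd * (A * A₁)) ^ 2 / (2 * (cd * A * (cd * A ^ 2 / 2))) := by
    rw [le_div_iff₀ (by positivity)]
    nlinarith [sq_nonneg (cd * A * (cd * A ^ 2 / 2) * (t - t₀) - cd * (A * A₁))]
  have hval : (cd * (A * A₁)) ^ 2 / (2 * (cd * A * (cd * A ^ 2 / 2))) = A₁ ^ 2 / A := by
    field_simp
  linarith

/-- **Duration of a growth phase.** Under the hypotheses of `successor_growth` (successor below its step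
`A₁` throughout), the window is short: `(c_d A²/2)(t₁ − t₀) ≤ A₁ − z(t₀)`. [this file] -/
theorem growthPhase_duration {y z w : ℝ → ℝ} {t₀ t₁ cd ce νz A A₁ : ℝ} (ht : t₀ ≤ t₁)
    (hcd : 0 ≤ cd) (hce : 0 ≤ ce) (hνz : 0 ≤ νz) (hA : 0 < A)
    (hz : ∀ t ∈ Icc t₀ t₁, HasDerivWithinAt z (cd * y t ^ 2 - ce * (z t * w t) - νz * z t) (Icc t₀ t₁) t)
    (hyA : ∀ t ∈ Icc t₀ t₁, A ≤ y t) (hzA : ∀ t ∈ Icc t₀ t₁, z t ≤ A₁)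
    (hw : ∀ t ∈ Icc t₀ t₁, 0 ≤ w t)
    (hdrain : ∀ t ∈ Icc t₀ t₁, (ce * w t + νz) * A₁ ≤ cd * A ^ 2 / 2) :
    cd * A ^ 2 / 2 * (t₁ - t₀) ≤ A₁ - z t₀ := by
  have h := successor_growth hce hνz hA hz hyA hzA hw hcd hdrain t₁ (right_mem_Icc.mpr ht)
  linarith [hzA t₁ (right_mem_Icc.mpr ht)]

/-- **No growth once the successor is Kolmogorov-high.** If on `[t₀,t₁]` the shell `y` obeys
`ẏ = c_f x² − c_d y z − ν_y y` with `c_d, ν_y ≥ 0`, the plateau bound `c_f x² ≤ c_d A A₁`, `y ≥ A ≥ 0` and the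
successor at or above its step, `z ≥ A₁ ≥ 0`, then `y` is non-increasing on the window. [this file] -/
theorem antitoneOn_of_successorHigh {x y z : ℝ → ℝ} {t₀ t₁ cf cd νy A A₁ : ℝ}
    (hcd : 0 ≤ cd) (hνy : 0 ≤ νy) (hA : 0 ≤ A) (hA₁ : 0 ≤ A₁)
    (hy : ∀ t ∈ Icc t₀ t₁, HasDerivWithinAt y (cf * x t ^ 2 - cd * (y t * z t) - νy * y t) (Icc t₀ t₁) t)
    (hfeed : ∀ t ∈ Icc t₀ t₁, cf * x t ^ 2 ≤ cd * (A * A₁))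
    (hyA : ∀ t ∈ Icc t₀ t₁, A ≤ y t) (hzA : ∀ t ∈ Icc t₀ t₁, A₁ ≤ z t) :
    AntitoneOn y (Icc t₀ t₁) := by
  apply antitoneOn_of_hasDerivWithinAt_nonpos (convex_Icc t₀ t₁)
    (f' := fun t => cf * x t ^ 2 - cd * (y t * z t) - νy * y t)
  · exact fun τ hτ => (hy τ hτ).continuousWithinAt
  · intro τ hτ
    exact (hy τ (interior_subset hτ)).mono interior_subset
  · intro τ hτ
    have hτ' : τ ∈ Icc t₀ t₁ := interior_subset hτ
    have hyτ := hyA τ hτ'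
    have hzτ := hzA τ hτ'
    have hy0 : 0 ≤ y τ := hA.trans hyτ
    have h1 : A * A₁ ≤ y τ * z τ := mul_le_mul hyτ hzτ hA₁ hy0
    have h2 : cd * (A * A₁) ≤ cd * (y τ * z τ) := mul_le_mul_of_nonneg_left h1 hcd
    have h3 : 0 ≤ νy * y τ := mul_nonneg hνy hy0
    have h4 := hfeed τ hτ'
    show cf * x τ ^ 2 - cd * (y τ * z τ) - νy * y τ ≤ 0
    linarith

/-- **First-passage overshoot over a whole episode.** Window `[t₀,t₁]`, switch time `σ ∈ [t₀,t₁]`: the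
growth-phase hypotheses of `overshoot_le_of_growthPhase` on `[t₀,σ]` (successor below its step, drain of the
successor small) and the successor at or above its step on `[σ,t₁]`, with the plateau bound and `y ≥ A`
throughout. Then `y(t) ≤ y(t₀) + A₁²/A` for every `t ∈ [t₀,t₁]`. [this file] -/
theorem overshoot_le_of_episode {x y z w : ℝ → ℝ} {t₀ σ t₁ cf cd ce νy νz A A₁ : ℝ}
    (hσ₀ : t₀ ≤ σ) (hσ₁ : σ ≤ t₁)
    (hcd : 0 < cd) (hce : 0 ≤ ce) (hνy : 0 ≤ νy) (hνz : 0 ≤ νz) (hA : 0 < A) (hA₁ : 0 ≤ A₁)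
    (hy : ∀ t ∈ Icc t₀ t₁, HasDerivWithinAt y (cf * x t ^ 2 - cd * (y t * z t) - νy * y t) (Icc t₀ t₁) t)
    (hz : ∀ t ∈ Icc t₀ t₁, HasDerivWithinAt z (cd * y t ^ 2 - ce * (z t * w t) - νz * z t) (Icc t₀ t₁) t)
    (hfeed : ∀ t ∈ Icc t₀ t₁, cf * x t ^ 2 ≤ cd * (A * A₁))
    (hyA : ∀ t ∈ Icc t₀ t₁, A ≤ y t)
    (hz0 : ∀ t ∈ Icc t₀ σ, 0 ≤ z t) (hzlow : ∀ t ∈ Icc t₀ σ, z t ≤ A₁)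
    (hw : ∀ t ∈ Icc t₀ σ, 0 ≤ w t)
    (hdrain : ∀ t ∈ Icc t₀ σ, (ce * w t + νz) * A₁ ≤ cd * A ^ 2 / 2)
    (hzhigh : ∀ t ∈ Icc σ t₁, A₁ ≤ z t) :
    ∀ t ∈ Icc t₀ t₁, y t ≤ y t₀ + A₁ ^ 2 / A := by
  have hsub₁ : Icc t₀ σ ⊆ Icc t₀ t₁ := Icc_subset_Icc le_rfl hσ₁
  have hsub₂ : Icc σ t₁ ⊆ Icc t₀ t₁ := Icc_subset_Icc hσ₀ le_rfl
  have hphase := overshoot_le_of_growthPhase hcd hce hνy hνz hA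
    (fun t ht => (hy t (hsub₁ ht)).mono hsub₁) (fun t ht => (hz t (hsub₁ ht)).mono hsub₁)
    (fun t ht => hfeed t (hsub₁ ht)) (fun t ht => hyA t (hsub₁ ht)) hz0 hzlow hw hdrain
  have hanti := antitoneOn_of_successorHigh hcd.le hνy hA.le hA₁
    (fun t ht => (hy t (hsub₂ ht)).mono hsub₂) (fun t ht => hfeed t (hsub₂ ht))
    (fun t ht => hyA t (hsub₂ ht)) hzhigh
  intro t ht
  rcases le_total t σ with hts | hst
  · exact hphase t ⟨ht.1, hts⟩
  · have h1 : y t ≤ y σ := hanti (left_mem_Icc.mpr hσ₁) ⟨hst, ht.2⟩ hst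
    have h2 := hphase σ (right_mem_Icc.mpr hσ₀)
    linarith

/-! ## The chain itself (hypotheses in the format of the LEAD's rungs) -/

/-- **First-passage overshoot of the Katz–Pavlović chain, growth phase.** Let `Z` solve the positive viscous
chain `Ż_k = c₀ (b^{5(k-1)/2} Z_{k-1}² − b^{5k/2} Z_k Z_{k+1}) − ν b^{2k} Z_k` within `[0,s]` (`b, c₀ > 0`,
`ν ≥ 0`). Fix a shell `k` (for the one-shell datum `Z_{-1} ≡ 0`, so `k = 0` is vacuous), a level `A > 0` (its Kolmogorov step) and a window `[t₀,t₁] ⊆ [0,s]` on which: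
the shell behind stays under the plateau `Z_{k-1}² ≤ b^{5/3} A²`; `Z_k ≥ A`; the successor is non-negative and
below ITS step, `Z_{k+1} ≤ b^{-5/6} A`; `Z_{k+2} ≥ 0`; and the successor's drain plus dissipation is small,
`(c₀ b^{5(k+1)/2} Z_{k+2} + ν b^{2(k+1)}) · b^{-5/6} A ≤ c₀ b^{5k/2} A²/2`. Then
`Z_k(t) ≤ Z_k(t₀) + b^{-5/3} A` on the window — an overshoot of at most the factor `1 + b^{-5/3}` above the step
when the phase is entered at `Z_k(t₀) = A`, for EVERY `b > 0`, uniformly in `ν`, `c₀`, `k`. [this file] -/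
theorem kpChain_firstPassage_overshoot {b c₀ ν s A t₀ t₁ : ℝ} (hb : 0 < b) (hc₀ : 0 < c₀) (hν : 0 ≤ ν)
    (hA : 0 < A) {Z : ℤ → ℝ → ℝ}
    (hode : ∀ k : ℕ, ∀ t ∈ Icc 0 s, HasDerivWithinAt (Z k)
      (c₀ * (b ^ ((5 : ℝ) * ((k : ℝ) - 1) / 2) * Z ((k : ℤ) - 1) t ^ 2 -
          b ^ ((5 : ℝ) * (k : ℝ) / 2) * (Z k t * Z ((k : ℤ) + 1) t)) -
        ν * b ^ ((2 : ℝ) * (k : ℝ)) * Z k t) (Icc 0 s) t)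
    {k : ℕ} (hwin : Icc t₀ t₁ ⊆ Icc 0 s)
    (hplat : ∀ t ∈ Icc t₀ t₁, Z ((k : ℤ) - 1) t ^ 2 ≤ b ^ ((5 : ℝ) / 3) * A ^ 2)
    (hZA : ∀ t ∈ Icc t₀ t₁, A ≤ Z k t)
    (hsucc0 : ∀ t ∈ Icc t₀ t₁, 0 ≤ Z ((k : ℤ) + 1) t)
    (hsuccA : ∀ t ∈ Icc t₀ t₁, Z ((k : ℤ) + 1) t ≤ b ^ (-(5 : ℝ) / 6) * A)
    (hahead : ∀ t ∈ Icc t₀ t₁, 0 ≤ Z ((k : ℤ) + 2) t)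
    (hdrain : ∀ t ∈ Icc t₀ t₁,
      (c₀ * b ^ ((5 : ℝ) * ((k : ℝ) + 1) / 2) * Z ((k : ℤ) + 2) t + ν * b ^ ((2 : ℝ) * ((k : ℝ) + 1))) *
          (b ^ (-(5 : ℝ) / 6) * A) ≤ c₀ * b ^ ((5 : ℝ) * (k : ℝ) / 2) * A ^ 2 / 2) :
    ∀ t ∈ Icc t₀ t₁, Z k t ≤ Z k t₀ + b ^ (-(5 : ℝ) / 3) * A := by
  -- the weights
  set cf : ℝ := c₀ * b ^ ((5 : ℝ) * ((k : ℝ) - 1) / 2) with hcf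
  set cd : ℝ := c₀ * b ^ ((5 : ℝ) * (k : ℝ) / 2) with hcd
  set ce : ℝ := c₀ * b ^ ((5 : ℝ) * ((k : ℝ) + 1) / 2) with hce
  set νy : ℝ := ν * b ^ ((2 : ℝ) * (k : ℝ)) with hνy
  set νz : ℝ := ν * b ^ ((2 : ℝ) * ((k : ℝ) + 1)) with hνz
  set A₁ : ℝ := b ^ (-(5 : ℝ) / 6) * A with hA₁
  have hcdpos : 0 < cd := by positivity
  have hcepos : 0 ≤ ce := by positivity
  have hνy0 : 0 ≤ νy := by positivity
  have hνz0 : 0 ≤ νz := by positivity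
  -- shell `k` in the abstract format
  have hy : ∀ t ∈ Icc t₀ t₁, HasDerivWithinAt (Z k)
      (cf * Z ((k : ℤ) - 1) t ^ 2 - cd * (Z k t * Z ((k : ℤ) + 1) t) - νy * Z k t) (Icc t₀ t₁) t := by
    intro t ht
    refine ((hode k t (hwin ht)).mono hwin).congr_deriv ?_
    rw [hcf, hcd, hνy]; ring
  -- shell `k+1` in the abstract format
  have hz : ∀ t ∈ Icc t₀ t₁, HasDerivWithinAt (Z ((k : ℤ) + 1))
      (cd * Z k t ^ 2 - ce * (Z ((k : ℤ) + 1) t * Z ((k : ℤ) + 2) t) - νz * Z ((k : ℤ) + 1) t)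
      (Icc t₀ t₁) t := by
    intro t ht
    have h := (hode (k + 1) t (hwin ht)).mono hwin
    have e1 : (((k + 1 : ℕ) : ℤ) : ℤ) = (k : ℤ) + 1 := by push_cast; ring
    have e2 : ((k + 1 : ℕ) : ℤ) - 1 = (k : ℤ) := by push_cast; ring
    have e3 : ((k + 1 : ℕ) : ℤ) + 1 = (k : ℤ) + 2 := by push_cast; ring
    have e4 : ((k + 1 : ℕ) : ℝ) = (k : ℝ) + 1 := by push_cast; ring
    rw [e2, e3, e4] at h
    simp only [e1] at h
    refine h.congr_deriv ?_
    rw [hcd, hce, hνz]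
    have e5 : (5 : ℝ) * ((k : ℝ) + 1 - 1) / 2 = (5 : ℝ) * (k : ℝ) / 2 := by ring
    rw [e5]
    ring
  -- the plateau bound is the equilibrium feed: `cf · b^{5/3} A² = cd · A · A₁`
  have hpow1 : b ^ ((5 : ℝ) * ((k : ℝ) - 1) / 2) * b ^ ((5 : ℝ) / 3) =
      b ^ ((5 : ℝ) * (k : ℝ) / 2) * b ^ (-(5 : ℝ) / 6) := by
    rw [← Real.rpow_add hb, ← Real.rpow_add hb]; congr 1; ring
  have hfeed : ∀ t ∈ Icc t₀ t₁, cf * Z ((k : ℤ) - 1) t ^ 2 ≤ cd * (A * A₁) := by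
    intro t ht
    have h1 : cf * Z ((k : ℤ) - 1) t ^ 2 ≤ cf * (b ^ ((5 : ℝ) / 3) * A ^ 2) :=
      mul_le_mul_of_nonneg_left (hplat t ht) (by positivity)
    have h2 : cf * (b ^ ((5 : ℝ) / 3) * A ^ 2) = cd * (A * A₁) := by
      rw [hcf, hcd, hA₁]
      have : c₀ * b ^ ((5 : ℝ) * ((k : ℝ) - 1) / 2) * (b ^ ((5 : ℝ) / 3) * A ^ 2) =
          c₀ * (b ^ ((5 : ℝ) * ((k : ℝ) - 1) / 2) * b ^ ((5 : ℝ) / 3)) * A ^ 2 := by ring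
      rw [this, hpow1]; ring
    linarith
  -- the drain smallness in the abstract format
  have hdrain' : ∀ t ∈ Icc t₀ t₁, (ce * Z ((k : ℤ) + 2) t + νz) * A₁ ≤ cd * A ^ 2 / 2 := by
    intro t ht
    have := hdrain t ht
    rw [hce, hνz, hA₁, hcd]
    exact this
  have hmain := overshoot_le_of_growthPhase (x := Z ((k : ℤ) - 1)) (w := Z ((k : ℤ) + 2)) hcdpos hcepos
    hνy0 hνz0 hA hy hz hfeed hZA hsucc0 hsuccA hahead hdrain'
  -- `A₁²/A = b^{-5/3} A`
  have hsq : (b ^ (-(5 : ℝ) / 6)) ^ 2 = b ^ (-(5 : ℝ) / 3) := by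
    rw [← Real.rpow_natCast, ← Real.rpow_mul hb.le]; norm_num
  have hval : A₁ ^ 2 / A = b ^ (-(5 : ℝ) / 3) * A := by
    rw [hA₁, mul_pow, hsq]
    field_simp
  intro t ht
  simpa only [hval] using hmain t ht

/-- **The same in the Kolmogorov-weighted energy currency.** In the situation of
`kpChain_firstPassage_overshoot` with the phase entered at the step, `Z_k(t₀) ≤ A`:
`b^{5/3} Z_k(t)² ≤ (1 + b^{-5/3})² · (b^{5/3} A²)` on the window, and `(1 + b^{-5/3})² ≤ 4` for `b ≥ 1` — at
most four times the plateau energy, uniformly in the scale ratio. [this file] -/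
theorem kpChain_firstPassage_overshoot_sq {b c₀ ν s A t₀ t₁ : ℝ} (hb : 0 < b) (hc₀ : 0 < c₀) (hν : 0 ≤ ν)
    (hA : 0 < A) {Z : ℤ → ℝ → ℝ}
    (hode : ∀ k : ℕ, ∀ t ∈ Icc 0 s, HasDerivWithinAt (Z k)
      (c₀ * (b ^ ((5 : ℝ) * ((k : ℝ) - 1) / 2) * Z ((k : ℤ) - 1) t ^ 2 -
          b ^ ((5 : ℝ) * (k : ℝ) / 2) * (Z k t * Z ((k : ℤ) + 1) t)) -
        ν * b ^ ((2 : ℝ) * (k : ℝ)) * Z k t) (Icc 0 s) t)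
    {k : ℕ} (hwin : Icc t₀ t₁ ⊆ Icc 0 s)
    (hplat : ∀ t ∈ Icc t₀ t₁, Z ((k : ℤ) - 1) t ^ 2 ≤ b ^ ((5 : ℝ) / 3) * A ^ 2)
    (hZA : ∀ t ∈ Icc t₀ t₁, A ≤ Z k t) (hstart : Z k t₀ ≤ A)
    (hsucc0 : ∀ t ∈ Icc t₀ t₁, 0 ≤ Z ((k : ℤ) + 1) t)
    (hsuccA : ∀ t ∈ Icc t₀ t₁, Z ((k : ℤ) + 1) t ≤ b ^ (-(5 : ℝ) / 6) * A)
    (hahead : ∀ t ∈ Icc t₀ t₁, 0 ≤ Z ((k : ℤ) + 2) t)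
    (hdrain : ∀ t ∈ Icc t₀ t₁,
      (c₀ * b ^ ((5 : ℝ) * ((k : ℝ) + 1) / 2) * Z ((k : ℤ) + 2) t + ν * b ^ ((2 : ℝ) * ((k : ℝ) + 1))) *
          (b ^ (-(5 : ℝ) / 6) * A) ≤ c₀ * b ^ ((5 : ℝ) * (k : ℝ) / 2) * A ^ 2 / 2) :
    ∀ t ∈ Icc t₀ t₁, b ^ ((5 : ℝ) / 3) * Z k t ^ 2 ≤ (1 + b ^ (-(5 : ℝ) / 3)) ^ 2 * (b ^ ((5 : ℝ) / 3) * A ^ 2) := by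
  intro t ht
  have h := kpChain_firstPassage_overshoot hb hc₀ hν hA hode hwin hplat hZA hsucc0 hsuccA hahead hdrain t ht
  have hZ0 : 0 ≤ Z k t := hA.le.trans (hZA t ht)
  have hup : Z k t ≤ (1 + b ^ (-(5 : ℝ) / 3)) * A := by nlinarith
  have hf0 : 0 ≤ (1 + b ^ (-(5 : ℝ) / 3)) * A := by positivity
  have hsq : Z k t ^ 2 ≤ ((1 + b ^ (-(5 : ℝ) / 3)) * A) ^ 2 := pow_le_pow_left₀ hZ0 hup 2
  have hw : 0 ≤ b ^ ((5 : ℝ) / 3) := by positivity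
  calc b ^ ((5 : ℝ) / 3) * Z k t ^ 2 ≤ b ^ ((5 : ℝ) / 3) * ((1 + b ^ (-(5 : ℝ) / 3)) * A) ^ 2 :=
        mul_le_mul_of_nonneg_left hsq hw
    _ = (1 + b ^ (-(5 : ℝ) / 3)) ^ 2 * (b ^ ((5 : ℝ) / 3) * A ^ 2) := by ring

/-- The numerical factor: `(1 + b^{-5/3})² ≤ 4` for every scale ratio `b ≥ 1`. [this file] -/
theorem overshoot_factor_le_four {b : ℝ} (hb : 1 ≤ b) : (1 + b ^ (-(5 : ℝ) / 3)) ^ 2 ≤ 4 := by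
  have h1 : b ^ (-(5 : ℝ) / 3) ≤ 1 := Real.rpow_le_one_of_one_le_of_nonpos hb (by norm_num)
  have h0 : 0 ≤ b ^ (-(5 : ℝ) / 3) := Real.rpow_nonneg (by linarith) _
  nlinarith

end Summit.NavierStokesRegularity.NavierStokesRegularity.Theorems.KPChainFirstPassage

end
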